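import Summits.ValiantsHypothesis.ValiantsHypothesis.Theorems.KPlusLogSqLawTropicalBTopHeavyCoreTransferSums
import Summits.ValiantsHypothesis.ValiantsHypothesis.Theorems.KPlusLogSqLawTropicalBTopHeavyCoreCensus

/-!
# Route «KPlusLogSqLaw», crux `TropicalB` (stmt-ValiantsHypothesis-19771) — DEFICIENCY GROWTH IN THE LEXICOGRAPHIC SECTOR:
# a lex cell misses at least `min(m − 1, #top classes)` histograms

HONEST FRAMING.  Census corollary (cell `pub-symmetroid`, seat val-sym-trop-p1 g23, 2026-08-29; `--supports stmt-ValiantsHypothesis-19771 --as helper`) of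
this seat's all-arrangement transfer law `TopHeavyCore.transfer_twoValued` (…TopHeavyCoreTransferSums, p673198).  A finite-format statement about the
UNSIGNED census of dominance designs; the first census law of the κ-programme whose DEFICIENCY GROWS with the format (every previous law — parity, lex
core, Core Law C, top-heavy census — proves ONE missing histogram, «they share the `C`-histogram», memo HOME/val-sym-trop-p1/g21/CORE-LAW-C-g21.md §7).
Still a LINEAR number of misses against the binomial `C(m+K−1, m)`: a calibration datum of the lexicographic sector, NOT a bound of `TropicalB` shape;
nothing here bears on `TropicalB` in its window, `WeakLifting`, DoorA26 / DoorA34, `MatrixDescartes` (stmt-ValiantsHypothesis-18050) or VP ≠ VNP.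

THE LAW (`topHeavy_deficiency`).  `m ≥ 2`; classes `c₀, c₁, c₂, c₃` with `d c₀ < d c₁ < d c₂ < d c₃`, `d c₀` minimal; `T` a set of TOP-HEAVY classes
`l`: `d c₃ + (m−1)·d c₂ < d l + (m−1)·d c₀` (no lacunarity asked of `d c₀ … d c₃`).  Every chain of unique optima at strictly increasing slopes with
consecutive terms distinct satisfies  **`n + 1 + min(m − 1, #T) ≤ multichoose K m`**.  WHY: the histograms `A_a = c₁^a c₂^{m−a}` and
`B_{a+1} = c₁^{a+1} c₂^{m−a−2} c₃` (`0 ≤ a ≤ m − 2`) and `C_l = c₀^{m−1} c_l` (`l ∈ T`) are pairwise distinct; every `C_l` is later (larger slope) than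
every `A_a`, `B_{a+1}`; by `transfer_twoValued` (every arrangement!) no chain contains `A_a`, `B_{a+1}` and a later `C_l` together.  So either every `C_l`
is missing (`#T` misses) or, for each `a`, one of `A_a`, `B_{a+1}` is missing (`m − 1` misses).  `lex_deficiency`: exponents super-increasing by the size,
`T` = any classes above `c₃`; `lex_deficiency_sorted`: sorted lex exponents on `K ≥ 4` classes miss `min(m − 1, K − 4)` histograms — against ONE from
`core_census_superIncreasing` (p660679).
Readers `twoValued_of_classSym`, `threeValued_of_classSym` (class function from a two- or three-valued class multiset) are included.
[this cell]
-/

set_option linter.dupNamespace false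
set_option autoImplicit false

namespace Summit.ValiantsHypothesis.ValiantsHypothesis.Theorems.KPlusLogSqLaw.TopHeavyCore

open Summit.ValiantsHypothesis.ValiantsHypothesis.Theorems.MatrixDescartes.Negative
open Summit.ValiantsHypothesis.ValiantsHypothesis.Theorems.LacunarySymmetroidMatrixDescartes.TropicalCensus
open Finset

variable {m K : ℕ}

/-! ## 1. Readers -/

/-- a term whose class multiset is `a·{c₁} + (m−a)·{c₂}` (`c₁ ≠ c₂`) has class `c₁` on an `a`-set and `c₂` elsewhere. [folklore] -/
theorem twoValued_of_classSym {p : Equiv.Perm (Fin m) × (Fin m → Fin K)} {c₁ c₂ : Fin K} (h12 : c₁ ≠ c₂) {a : ℕ}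
    (h : (classSym p : Multiset (Fin K)) = Multiset.replicate a c₁ + Multiset.replicate (m - a) c₂) :
    ∃ P : Finset (Fin m), P.card = a ∧ ∀ x, p.2 x = if x ∈ P then c₁ else c₂ := by
  classical
  have hval : (classSym p : Multiset (Fin K)) = (univ : Finset (Fin m)).val.map p.2 := rfl
  refine ⟨univ.filter fun x => c₁ = p.2 x, ?_, fun x => ?_⟩
  · have hcount : Multiset.count c₁ ((univ : Finset (Fin m)).val.map p.2) = a := by
      rw [← hval, h, Multiset.count_add, Multiset.count_replicate_self, Multiset.count_replicate, if_neg h12.symm, add_zero]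
    rw [Finset.card_def, Finset.filter_val, ← Multiset.count_map p.2 (univ : Finset (Fin m)).val c₁, hcount]
  · by_cases hx : c₁ = p.2 x
    · rw [if_pos (show x ∈ univ.filter (fun x => c₁ = p.2 x) from mem_filter.mpr ⟨mem_univ _, hx⟩)]; exact hx.symm
    · rw [if_neg (show x ∉ univ.filter (fun x => c₁ = p.2 x) from fun h' => hx (mem_filter.mp h').2)]
      have hmem : p.2 x ∈ (univ : Finset (Fin m)).val.map p.2 := Multiset.mem_map_of_mem _ (mem_univ x)
      rw [← hval, h, Multiset.mem_add] at hmem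
      rcases hmem with h1 | h2
      · exact absurd (Multiset.eq_of_mem_replicate h1).symm hx
      · exact Multiset.eq_of_mem_replicate h2

/-- a term whose class multiset is `{c₃} + a·{c₁} + (m−a−1)·{c₂}` (distinct classes) has `c₃` at one column `s`, `c₁` on an `a`-set `Q ∌ s`,
`c₂` elsewhere. [folklore] -/
theorem threeValued_of_classSym {p : Equiv.Perm (Fin m) × (Fin m → Fin K)} {c₁ c₂ c₃ : Fin K} (h12 : c₁ ≠ c₂) (h13 : c₁ ≠ c₃)
    (h23 : c₂ ≠ c₃) {a : ℕ}
    (h : (classSym p : Multiset (Fin K)) = c₃ ::ₘ (Multiset.replicate a c₁ + Multiset.replicate (m - a - 1) c₂)) :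
    ∃ (s : Fin m) (Q : Finset (Fin m)), s ∉ Q ∧ Q.card = a ∧ ∀ x, p.2 x = if x = s then c₃ else if x ∈ Q then c₁ else c₂ := by
  classical
  have hval : (classSym p : Multiset (Fin K)) = (univ : Finset (Fin m)).val.map p.2 := rfl
  have hc3 : c₃ ∈ (univ : Finset (Fin m)).val.map p.2 := by rw [← hval, h]; exact Multiset.mem_cons_self _ _
  obtain ⟨s, -, hs⟩ := Multiset.mem_map.mp hc3
  refine ⟨s, univ.filter fun x => c₁ = p.2 x, fun h' => h13 ((mem_filter.mp h').2.trans hs), ?_, fun x => ?_⟩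
  · have hcount : Multiset.count c₁ ((univ : Finset (Fin m)).val.map p.2) = a := by
      rw [← hval, h, Multiset.count_cons_of_ne h13, Multiset.count_add, Multiset.count_replicate_self, Multiset.count_replicate,
        if_neg h12.symm, add_zero]
    rw [Finset.card_def, Finset.filter_val, ← Multiset.count_map p.2 (univ : Finset (Fin m)).val c₁, hcount]
  · by_cases hxs : x = s
    · rw [if_pos hxs, hxs, hs]
    rw [if_neg hxs]
    by_cases hx : c₁ = p.2 x
    · rw [if_pos (show x ∈ univ.filter (fun x => c₁ = p.2 x) from mem_filter.mpr ⟨mem_univ _, hx⟩)]; exact hx.symm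
    rw [if_neg (show x ∉ univ.filter (fun x => c₁ = p.2 x) from fun h' => hx (mem_filter.mp h').2)]
    have hmem : p.2 x ∈ (univ : Finset (Fin m)).val.map p.2 := Multiset.mem_map_of_mem _ (mem_univ x)
    rw [← hval, h, Multiset.mem_cons, Multiset.mem_add] at hmem
    rcases hmem with h3 | h1 | h2
    · -- two columns of class `c₃` contradict the count
      exfalso
      have hcount : Multiset.count c₃ ((univ : Finset (Fin m)).val.map p.2) = 1 := by
        rw [← hval, h, Multiset.count_cons_self, Multiset.count_add, Multiset.count_replicate, Multiset.count_replicate,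
          if_neg h13, if_neg h23]
      have hsub : (({s, x} : Finset (Fin m)).val.map p.2) ≤ (univ : Finset (Fin m)).val.map p.2 :=
        Multiset.map_le_map (Finset.val_le_iff.mpr (Finset.subset_univ _))
      have hpair : ({s, x} : Finset (Fin m)).val = s ::ₘ {x} := by
        rw [Finset.insert_val, Multiset.ndinsert_of_notMem (by simpa using (Ne.symm hxs))]; rfl
      have htwo : Multiset.count c₃ ((({s, x} : Finset (Fin m)).val.map p.2)) = 2 := by
        rw [hpair, Multiset.map_cons, Multiset.map_singleton, hs, h3, Multiset.count_cons_self, Multiset.count_singleton_self]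
      have := Multiset.count_le_of_le c₃ hsub
      omega
    · exact absurd (Multiset.eq_of_mem_replicate h1).symm hx
    · exact Multiset.eq_of_mem_replicate h2

/-! ## 2. The lexicographic deficiency law -/

/-- **DEFICIENCY GROWTH BELOW TOP-HEAVY CLASSES.**  `m ≥ 2`; classes `d c₀ < d c₁ < d c₂ < d c₃`, `d c₀` minimal; `T` a set of classes `l`
that are TOP-HEAVY over the pairs: `d c₃ + (m−1)·d c₂ < d l + (m−1)·d c₀`.  Every chain of unique optima at strictly increasing slopes with
consecutive terms distinct misses at least `min(m − 1, #T)` class histograms: `n + 1 + min(m − 1, #T) ≤ multichoose K m`. [this cell] -/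
theorem topHeavy_deficiency (hm : 2 ≤ m) (d : Fin K → ℕ)
    (v ε : Fin m → Fin m → Fin K → ℤ) (c₀ c₁ c₂ c₃ : Fin K) (hmin : ∀ l, d c₀ ≤ d l)
    (h01 : d c₀ < d c₁) (h12 : d c₁ < d c₂) (h23 : d c₂ < d c₃) (T : Finset (Fin K))
    (hTop : ∀ l ∈ T, (d c₃ : ℤ) + ((m : ℤ) - 1) * d c₂ < d l + ((m : ℤ) - 1) * d c₀)
    {n : ℕ} (θ : Fin (n + 1) → ℤ) (p : Fin (n + 1) → Equiv.Perm (Fin m) × (Fin m → Fin K))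
    (hθ : StrictMono θ) (hdom : ∀ k, IsDominant d v ε (θ k) (p k)) (hne : ∀ k : Fin n, p k.castSucc ≠ p k.succ) :
    n + 1 + min (m - 1) T.card ≤ Nat.multichoose K m := by
  classical
  have hmz : (2 : ℤ) ≤ m := by exact_mod_cast hm
  have hT : ∀ l ∈ T, d c₃ < d l := by
    intro l hl
    have h := hTop l hl
    have e1 : ((m : ℤ) - 1) * d c₀ ≤ ((m : ℤ) - 1) * d c₂ :=
      mul_le_mul_of_nonneg_left (by exact_mod_cast (h01.trans h12).le) (by linarith)
    exact_mod_cast (show (d c₃ : ℤ) < d l by linarith)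
  -- slopes increase, class multisets are pairwise distinct
  have hsm : StrictMono fun k => slope d (p k) := by
    rw [Fin.strictMono_iff_lt_succ]
    intro k
    exact slope_lt_of_dominant d v ε (hθ Fin.castSucc_lt_succ) (hne k) (hdom _) (hdom _)
  have hinj : Function.Injective fun k => classSym (p k) := by
    intro k k' h
    apply hsm.injective
    simp only
    rw [slope_eq_of_classSym, slope_eq_of_classSym]
    exact congrArg (fun M : Sym (Fin K) m => ((M : Multiset (Fin K)).map fun l => (d l : ℤ)).sum) h
  set I : Finset (Sym (Fin K) m) := univ.image fun k => classSym (p k) with hI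
  have hIcard : I.card = n + 1 := by rw [hI, card_image_of_injective _ hinj, card_univ, Fintype.card_fin]
  -- counting: a set of histograms missed by the chain bounds the length
  have count : ∀ M : Finset (Sym (Fin K) m), Disjoint M I → n + 1 + M.card ≤ Nat.multichoose K m := by
    intro M hMI
    have h1 : (I ∪ M).card ≤ Fintype.card (Sym (Fin K) m) := card_le_univ _
    rw [card_union_of_disjoint hMI.symm, hIcard, Sym.card_sym_eq_multichoose, Fintype.card_fin] at h1
    exact h1
  -- class facts
  have hc12 : c₁ ≠ c₂ := fun e => by rw [e] at h12; exact lt_irrefl _ h12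
  have hc13 : c₁ ≠ c₃ := fun e => by rw [e] at h12; exact lt_asymm h12 h23
  have hc23 : c₂ ≠ c₃ := fun e => by rw [e] at h23; exact lt_irrefl _ h23
  have hTc0 : ∀ l ∈ T, c₀ ≠ l := fun l hl e => by
    have := hT l hl; rw [← e] at this; exact lt_asymm (h01.trans (h12.trans h23)) this
  -- the histograms
  have cardA : ∀ a : Fin (m - 1), Multiset.card (Multiset.replicate (a : ℕ) c₁ + Multiset.replicate (m - a) c₂) = m := fun a => by
    rw [Multiset.card_add, Multiset.card_replicate, Multiset.card_replicate]; omega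
  have cardB : ∀ a : Fin (m - 1),
      Multiset.card (c₃ ::ₘ (Multiset.replicate ((a : ℕ) + 1) c₁ + Multiset.replicate (m - (a + 1) - 1) c₂)) = m := fun a => by
    rw [Multiset.card_cons, Multiset.card_add, Multiset.card_replicate, Multiset.card_replicate]; omega
  have cardC : ∀ l : Fin K, Multiset.card (l ::ₘ Multiset.replicate (m - 1) c₀) = m := fun l => by
    rw [Multiset.card_cons, Multiset.card_replicate]; omega
  let hA : Fin (m - 1) → Sym (Fin K) m := fun a => ⟨_, cardA a⟩
  let hB : Fin (m - 1) → Sym (Fin K) m := fun a => ⟨_, cardB a⟩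
  let hC : Fin K → Sym (Fin K) m := fun l => ⟨_, cardC l⟩
  -- exponent facts in `ℤ`
  have h01z : (d c₀ : ℤ) < d c₁ := by exact_mod_cast h01
  have h12z : (d c₁ : ℤ) < d c₂ := by exact_mod_cast h12
  have h23z : (d c₂ : ℤ) < d c₃ := by exact_mod_cast h23
  -- THE PAIR LAW in chain form: `A_a`, `B_{a+1}` and a later `C_l` are never all in the chain
  have pair : ∀ (l : Fin K), l ∈ T → hC l ∈ I → ∀ a : Fin (m - 1), hA a ∈ I → hB a ∈ I → False := by
    intro l hlT hCI a hAI hBI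
    obtain ⟨kC, -, hkC⟩ := mem_image.mp hCI
    obtain ⟨kA, -, hkA⟩ := mem_image.mp hAI
    obtain ⟨kB, -, hkB⟩ := mem_image.mp hBI
    have hkC' : (classSym (p kC) : Multiset (Fin K)) = l ::ₘ Multiset.replicate (m - 1) c₀ := congrArg Subtype.val hkC
    have hkA' : (classSym (p kA) : Multiset (Fin K)) = Multiset.replicate (a : ℕ) c₁ + Multiset.replicate (m - a) c₂ :=
      congrArg Subtype.val hkA
    have hkB' : (classSym (p kB) : Multiset (Fin K)) =
        c₃ ::ₘ (Multiset.replicate ((a : ℕ) + 1) c₁ + Multiset.replicate (m - (a + 1) - 1) c₂) := congrArg Subtype.val hkB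
    -- shapes
    obtain ⟨c, hc, hlC⟩ := ParityLaw.oneOff_of_classSym_cons (hTc0 l hlT) hkC'
    obtain ⟨P, hPcard, hlA⟩ := twoValued_of_classSym hc12 hkA'
    obtain ⟨s, Q, hsQ, hQcard, hlB⟩ := threeValued_of_classSym hc12 hc13 hc23 hkB'
    -- slopes
    have ha : (a : ℕ) + 1 ≤ m - 1 := a.isLt
    have hl4 := hTop l hlT
    have slA : slope d (p kA) = (a : ℕ) * (d c₁ : ℤ) + ((m - a : ℕ) : ℤ) * d c₂ := by
      rw [slope_eq_of_classSym, hkA', Multiset.map_add, Multiset.sum_add, Multiset.map_replicate, Multiset.map_replicate,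
        Multiset.sum_replicate, Multiset.sum_replicate, nsmul_eq_mul, nsmul_eq_mul]
    have slB : slope d (p kB) = (d c₃ : ℤ) + (((a : ℕ) + 1 : ℕ) : ℤ) * d c₁ + ((m - (a + 1) - 1 : ℕ) : ℤ) * d c₂ := by
      rw [slope_eq_of_classSym, hkB', Multiset.map_cons, Multiset.sum_cons, Multiset.map_add, Multiset.sum_add, Multiset.map_replicate,
        Multiset.map_replicate, Multiset.sum_replicate, Multiset.sum_replicate, nsmul_eq_mul, nsmul_eq_mul]
      ring
    have slC : slope d (p kC) = (d l : ℤ) + ((m - 1 : ℕ) : ℤ) * d c₀ := by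
      rw [slope_eq_of_classSym, hkC', Multiset.map_cons, Multiset.sum_cons, Multiset.map_replicate, Multiset.sum_replicate, nsmul_eq_mul]
    have hAC : kA < kC := by
      have hs : slope d (p kA) < slope d (p kC) := by
        rw [slA, slC]
        have e1 : ((a : ℕ) : ℤ) * (d c₁ : ℤ) ≤ ((a : ℕ) : ℤ) * d c₂ := mul_le_mul_of_nonneg_left h12z.le (by positivity)
        have e2 : ((a : ℕ) : ℤ) + ((m - a : ℕ) : ℤ) = m := by
          have : (a : ℕ) + (m - a) = m := by omega
          exact_mod_cast this
        have e4 : (((m - 1 : ℕ) : ℤ)) = (m : ℤ) - 1 := by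
          have : 1 ≤ m := by omega
          push_cast [Nat.cast_sub this]; ring
        have e5 : (0 : ℤ) ≤ ((m - a : ℕ) : ℤ) := by positivity
        have e6 : (d c₂ : ℤ) < d c₃ := h23z
        nlinarith
      exact hsm.lt_iff_lt.mp hs
    have hBC : kB < kC := by
      have hs : slope d (p kB) < slope d (p kC) := by
        rw [slB, slC]
        have e1 : ((((a : ℕ) + 1 : ℕ) : ℤ)) * (d c₁ : ℤ) ≤ ((((a : ℕ) + 1 : ℕ) : ℤ)) * d c₂ := mul_le_mul_of_nonneg_left h12z.le (by positivity)
        have e2 : ((((a : ℕ) + 1 : ℕ) : ℤ)) + ((m - (a + 1) - 1 : ℕ) : ℤ) = ((m - 1 : ℕ) : ℤ) := by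
          have : ((a : ℕ) + 1) + (m - (a + 1) - 1) = m - 1 := by omega
          exact_mod_cast this
        have e4 : (((m - 1 : ℕ) : ℤ)) = (m : ℤ) - 1 := by
          have : 1 ≤ m := by omega
          push_cast [Nat.cast_sub this]; ring
        have e5 : (0 : ℤ) ≤ ((m - (a + 1) - 1 : ℕ) : ℤ) := by positivity
        nlinarith
      exact hsm.lt_iff_lt.mp hs
    have hA := hdom kA
    have hB := hdom kB
    have hCdom := hdom kC
    have hlC' : ∀ x, x ≠ c → (p kC).2 x = c₀ := hlC
    exact transfer_twoValued d v ε h01 h12 h23 (σA := (p kA).1) (σB := (p kB).1) (σC := (p kC).1) (lA := (p kA).2) (lB := (p kB).2)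
      (lC := (p kC).2) (by rw [hQcard, hPcard]) hsQ hlA hlB hlC' (fun x => hmin _) hA hB hCdom (hθ hAC) (hθ hBC)
  -- injectivity of the histogram families (by counting `c₁`, resp. `c₃`, resp. the top class)
  have cntA : ∀ a : Fin (m - 1), Multiset.count c₁ (hA a : Multiset (Fin K)) = a := fun a => by
    show Multiset.count c₁ (Multiset.replicate (a : ℕ) c₁ + Multiset.replicate (m - a) c₂) = a
    rw [Multiset.count_add, Multiset.count_replicate_self, Multiset.count_replicate, if_neg hc12.symm, add_zero]
  have cntB : ∀ a : Fin (m - 1), Multiset.count c₁ (hB a : Multiset (Fin K)) = a + 1 := fun a => by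
    show Multiset.count c₁ (c₃ ::ₘ (Multiset.replicate ((a : ℕ) + 1) c₁ + Multiset.replicate (m - (a + 1) - 1) c₂)) = a + 1
    rw [Multiset.count_cons_of_ne hc13, Multiset.count_add, Multiset.count_replicate_self, Multiset.count_replicate,
      if_neg hc12.symm, add_zero]
  have cnt3A : ∀ a : Fin (m - 1), Multiset.count c₃ (hA a : Multiset (Fin K)) = 0 := fun a => by
    show Multiset.count c₃ (Multiset.replicate (a : ℕ) c₁ + Multiset.replicate (m - a) c₂) = 0
    rw [Multiset.count_add, Multiset.count_replicate, Multiset.count_replicate, if_neg hc13, if_neg hc23]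
  have cnt3B : ∀ a : Fin (m - 1), Multiset.count c₃ (hB a : Multiset (Fin K)) = 1 := fun a => by
    show Multiset.count c₃ (c₃ ::ₘ (Multiset.replicate ((a : ℕ) + 1) c₁ + Multiset.replicate (m - (a + 1) - 1) c₂)) = 1
    rw [Multiset.count_cons_self, Multiset.count_add, Multiset.count_replicate, Multiset.count_replicate, if_neg hc13, if_neg hc23]
  have hAB_ne : ∀ a a' : Fin (m - 1), hA a ≠ hB a' := fun a a' e => by
    have := congrArg (fun M : Sym (Fin K) m => Multiset.count c₃ (M : Multiset (Fin K))) e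
    simp only [cnt3A, cnt3B] at this
    exact Nat.zero_ne_one this
  by_cases hCpres : ∃ l ∈ T, hC l ∈ I
  · -- some top-heavy term is in the chain: one of `A_a`, `B_{a+1}` is missing for every `a`
    obtain ⟨l, hlT, hCI⟩ := hCpres
    let f : Fin (m - 1) → Sym (Fin K) m := fun a => if hA a ∈ I then hB a else hA a
    have hfI : ∀ a, f a ∉ I := by
      intro a
      by_cases h : hA a ∈ I
      · simp only [f, if_pos h]; exact fun hBI => pair l hlT hCI a h hBI
      · simp only [f, if_neg h]; exact h
    have hfinj : Function.Injective f := by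
      intro a a' e
      by_cases h : hA a ∈ I
      · by_cases h' : hA a' ∈ I
        · have e' : hB a = hB a' := by have e2 := e; simp only [f, if_pos h, if_pos h'] at e2; exact e2
          have := congrArg (fun M : Sym (Fin K) m => Multiset.count c₁ (M : Multiset (Fin K))) e'
          simp only [cntB] at this
          exact Fin.ext (by omega)
        · have e' : hB a = hA a' := by have e2 := e; simp only [f, if_pos h, if_neg h'] at e2; exact e2
          exact absurd e'.symm (hAB_ne a' a)
      · by_cases h' : hA a' ∈ I
        · have e' : hA a = hB a' := by have e2 := e; simp only [f, if_neg h, if_pos h'] at e2; exact e2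
          exact absurd e' (hAB_ne a a')
        · have e' : hA a = hA a' := by have e2 := e; simp only [f, if_neg h, if_neg h'] at e2; exact e2
          have := congrArg (fun M : Sym (Fin K) m => Multiset.count c₁ (M : Multiset (Fin K))) e'
          simp only [cntA] at this
          exact Fin.ext this
    have hM := count (univ.image f) (by
      rw [Finset.disjoint_left]
      intro x hx
      obtain ⟨a, -, rfl⟩ := mem_image.mp hx
      exact hfI a)
    rw [card_image_of_injective _ hfinj, card_univ, Fintype.card_fin] at hM
    have := Nat.min_le_left (m - 1) T.card
    omega
  · -- every top-heavy histogram is missing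
    push Not at hCpres
    have hCinj : Set.InjOn hC T := by
      intro l hl l' hl' e
      have h1 := congrArg (fun M : Sym (Fin K) m => Multiset.count l (M : Multiset (Fin K))) e
      simp only [hC] at h1
      change Multiset.count l (l ::ₘ Multiset.replicate (m - 1) c₀) = Multiset.count l (l' ::ₘ Multiset.replicate (m - 1) c₀) at h1
      rw [Multiset.count_cons_self, Multiset.count_replicate, if_neg (hTc0 l hl)] at h1
      by_contra hne'
      rw [Multiset.count_cons_of_ne hne', Multiset.count_replicate, if_neg (hTc0 l hl)] at h1
      omega
    have hM := count (T.image hC) (by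
      rw [Finset.disjoint_left]
      intro x hx
      obtain ⟨l, hl, rfl⟩ := mem_image.mp hx
      exact hCpres l hl)
    rw [card_image_of_injOn hCinj] at hM
    have := Nat.min_le_right (m - 1) T.card
    omega

/-- **DEFICIENCY GROWTH IN THE LEX SECTOR.**  `m ≥ 2`; exponents super-increasing by the size (`d l < d l' → m·d l < d l'`); classes
`d c₀ < d c₁ < d c₂ < d c₃`, `d c₀` minimal; `T` any set of classes with exponents above `d c₃`.  Every chain misses at least `min(m − 1, #T)` class
histograms. [this cell] -/
theorem lex_deficiency (hm : 2 ≤ m) (d : Fin K → ℕ) (hsup : ∀ l l' : Fin K, d l < d l' → m * d l < d l')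
    (v ε : Fin m → Fin m → Fin K → ℤ) (c₀ c₁ c₂ c₃ : Fin K) (hmin : ∀ l, d c₀ ≤ d l)
    (h01 : d c₀ < d c₁) (h12 : d c₁ < d c₂) (h23 : d c₂ < d c₃) (T : Finset (Fin K)) (hT : ∀ l ∈ T, d c₃ < d l)
    {n : ℕ} (θ : Fin (n + 1) → ℤ) (p : Fin (n + 1) → Equiv.Perm (Fin m) × (Fin m → Fin K))
    (hθ : StrictMono θ) (hdom : ∀ k, IsDominant d v ε (θ k) (p k)) (hne : ∀ k : Fin n, p k.castSucc ≠ p k.succ) :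
    n + 1 + min (m - 1) T.card ≤ Nat.multichoose K m := by
  refine topHeavy_deficiency hm d v ε c₀ c₁ c₂ c₃ hmin h01 h12 h23 T (fun l hl => ?_) θ p hθ hdom hne
  have h4 : (m : ℤ) * d c₃ < d l := by exact_mod_cast hsup c₃ l (hT l hl)
  have h23z : (d c₂ : ℤ) < d c₃ := by exact_mod_cast h23
  have hmz : (2 : ℤ) ≤ m := by exact_mod_cast hm
  have e1 : ((m : ℤ) - 1) * d c₂ ≤ ((m : ℤ) - 1) * d c₃ := mul_le_mul_of_nonneg_left h23z.le (by linarith)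
  have e2 : (0 : ℤ) ≤ ((m : ℤ) - 1) * d c₀ := mul_nonneg (by linarith) (by positivity)
  nlinarith

/-- **SORTED FORM**: `K` classes with strictly increasing, super-increasing exponents (`d : Fin K → ℕ` strictly monotone, `m·d l < d l'` for
`l < l'`), `K ≥ 4`, `m ≥ 2`: every chain has `n + 1 + min(m − 1, K − 4) ≤ multichoose K m` — a lexicographic cell misses at least
`min(m − 1, K − 4)` class histograms. [this cell] -/
theorem lex_deficiency_sorted (hm : 2 ≤ m) (hK : 4 ≤ K) (d : Fin K → ℕ) (hmono : StrictMono d)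
    (hsup : ∀ l l' : Fin K, d l < d l' → m * d l < d l') (v ε : Fin m → Fin m → Fin K → ℤ)
    {n : ℕ} (θ : Fin (n + 1) → ℤ) (p : Fin (n + 1) → Equiv.Perm (Fin m) × (Fin m → Fin K))
    (hθ : StrictMono θ) (hdom : ∀ k, IsDominant d v ε (θ k) (p k)) (hne : ∀ k : Fin n, p k.castSucc ≠ p k.succ) :
    n + 1 + min (m - 1) (K - 4) ≤ Nat.multichoose K m := by
  classical
  let c₀ : Fin K := ⟨0, by omega⟩
  let c₁ : Fin K := ⟨1, by omega⟩
  let c₂ : Fin K := ⟨2, by omega⟩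
  let c₃ : Fin K := ⟨3, by omega⟩
  let e : Fin (K - 4) → Fin K := fun i => ⟨(i : ℕ) + 4, by omega⟩
  have he : Function.Injective e := fun i j h => by
    apply Fin.ext
    have := congrArg Fin.val h
    simp only [e] at this
    omega
  have hTcard : ((univ : Finset (Fin (K - 4))).image e).card = K - 4 := by
    rw [card_image_of_injective _ he, card_univ, Fintype.card_fin]
  have hT : ∀ l ∈ (univ : Finset (Fin (K - 4))).image e, d c₃ < d l := by
    intro l hl
    obtain ⟨i, -, rfl⟩ := mem_image.mp hl
    exact hmono (Fin.mk_lt_mk.mpr (by omega))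
  have hmin : ∀ l, d c₀ ≤ d l := fun l => hmono.monotone (Fin.le_iff_val_le_val.mpr (Nat.zero_le _))
  have h := lex_deficiency hm d hsup v ε c₀ c₁ c₂ c₃ hmin (hmono (Fin.mk_lt_mk.mpr (by norm_num)))
    (hmono (Fin.mk_lt_mk.mpr (by norm_num))) (hmono (Fin.mk_lt_mk.mpr (by norm_num))) _ hT θ p hθ hdom hne
  rw [hTcard] at h
  exact h

end Summit.ValiantsHypothesis.ValiantsHypothesis.Theorems.KPlusLogSqLaw.TopHeavyCore
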